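import Literature.Computability.Complexity.PromiseCookMachine
import Literature.Computability.Complexity.LengthCompare
import Literature.Computability.Complexity.BrickAlgebra
import HarnessLib

/-!
# Textbook promise-`BPP` from a one-bit `FP` decider on (instance, coins) pairs

Topic `Computability/Complexity`. A generic compilation lemma for machine-level randomized reductions
(written for the machine of MR07 Thm. 5.23, `Literature.Computability.Cryptography.MicciancioRegev2007_gapCVP'_to_SIS'`, and
usable by any seat): the class `PromiseBPP'` (Goldreich 2006, Def. 1.2: some `L′ ∈ P` and a polynomial `p` with
`Pr_{y ∈ {0,1}^{p(|x|)}}[⟨x, y⟩ ∈ L′] ≥ 2/3` on YES instances and `≤ 1/3` on NO instances) is witnessed by any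
total string function `dec ∈ FP` with one-bit values: take `L′ = {z | dec z = [true]}` (in `P` by
`mem_P_of_mem_FP`). So a randomized reduction presented as "deterministic machine on `⟨input, coins⟩`" puts its
promise problem in `PromiseBPP'` as soon as its acceptance probabilities are bounded:

* `decLangOf dec` (definition) and `decLangOf_mem_P`;
* **`PromiseProblem.mem_PromiseBPP'_of_fp_decider`** — if `dec ∈ FP` is one-bit and, for a polynomial `p`,
  `uniformProb (p |x|) {y | dec ⟨x, y⟩ = [true]} ≥ 2/3` on `Q.yes` and `uniformProb (p |x|) {y | dec ⟨x, y⟩ = [false]} ≥ 2/3`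
  on `Q.no`, then `Q ∈ PromiseBPP'`.

## References

* O. Goldreich, *On promise problems: a survey*, LNCS 3895 (2006) 254–290, Def. 1.2 (promise-BPP) [Goldreich2006].
* S. Arora, B. Barak, *Computational Complexity: A Modern Approach*, CUP 2009, Def. 7.3 and §1.3 [AroraBarak2009].
-/

namespace Literature.Computability.Complexity

open _root_.Computability Brick

/-- The language accepted by a string function: `{z | dec z = [true]}`. [folklore] -/
def decLangOf (dec : List Bool → List Bool) : Language Bool := {z | dec z = [true]}

/-- `decLangOf dec ∈ P` for a one-bit `dec ∈ FP`. [cite: AroraBarak2009, Def. 1.13 and §1.3] -/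
theorem decLangOf_mem_P {dec : List Bool → List Bool} (hdec : dec ∈ FP) (h1 : OneBit dec) : decLangOf dec ∈ Classes.P :=
  mem_P_of_mem_FP hdec _ fun w =>
    ⟨fun h => h, fun h => by
      obtain ⟨b, hb⟩ := h1 w
      cases b
      · exact hb
      · exact absurd hb h⟩

/-- **Promise-`BPP` from a one-bit `FP` decider** (Goldreich 2006, Def. 1.2): if `dec ∈ FP` is one-bit on every
string and a polynomial `p` bounds the coins so that `Pr_{y ∈ {0,1}^{p(|x|)}}[dec ⟨x, y⟩ = [true]] ≥ 2/3` for
`x ∈ Q.yes` and `Pr_y[dec ⟨x, y⟩ = [false]] ≥ 2/3` for `x ∈ Q.no`, then `Q ∈ PromiseBPP'`.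
[cite: Goldreich2006, Def. 1.2 (promise-BPP)] [cite: AroraBarak2009, Def. 7.3] -/
theorem PromiseProblem.mem_PromiseBPP'_of_fp_decider (Q : PromiseProblem) {dec : List Bool → List Bool} (hdec : dec ∈ FP)
    (h1 : OneBit dec) (p : Polynomial ℕ)
    (hyes : ∀ x ∈ Q.yes, (2 / 3 : ℝ) ≤ uniformProb (p.eval x.length) {y | dec (boolPair x y) = [true]})
    (hno : ∀ x ∈ Q.no, (2 / 3 : ℝ) ≤ uniformProb (p.eval x.length) {y | dec (boolPair x y) = [false]}) :
    Q ∈ PromiseBPP' := by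
  refine ⟨decLangOf dec, decLangOf_mem_P hdec h1, p, fun x hx => hyes x hx, fun x hx => (hno x hx).trans (PromiseCook.uniformProb_mono ?_)⟩
  intro y hy
  change ¬ dec (boolPair x y) = [true]
  rw [show dec (boolPair x y) = [false] from hy]
  decide

end Literature.Computability.Complexity
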